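import Literature.AnabelianGeometry.SemiGraphs.TemperedPiOrbit
import Literature.AnabelianGeometry.SemiGraphs.SigmaCovering

/-!
# Essential surjectivity of the fibre functor ([SemiAnbd] Prop. 3.6 (ii), p. 38)

Sequel to `TemperedPiOrbit.lean` and `SigmaCovering.lean`.  For Galois level data `D` whose levels
split themselves and are finite with nonempty fibres, every object `X` of `B^temp(π₁^temp(𝒢))` is
realised: decompose `X` into its (countably many) orbits, realise each orbit as the fibre of a
quotient covering `𝒢_{∞,n}/K` (`TemperedPiOrbit.lean`), and take the disjoint union
(`realize X`, tempered); an explicit equivariant bijection `Φ(realize X) ≅ X` (`realizeIso`).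
-/

namespace Literature.AnabelianGeometry.SemiGraphs

namespace ProfiniteSemiGraph

open CategoryTheory Topology

universe u

variable {𝒢 : ProfiniteSemiGraph.{u}}

namespace GaloisLevelData

variable (D : GaloisLevelData 𝒢) (h𝒢 : 𝒢.IsCountable) (X : BTemp (D.temperedPi h𝒢))

/-- The orbit relation on `X`. [cite: MochizukiSemiAnbd2006, Prop 3.6(ii) p.38] -/
def orbitSetoid : Setoid X.obj.V where
  r x y := ∃ γ : D.temperedPi h𝒢, X.obj.ρ γ x = y
  iseqv :=
    { refl := fun x => ⟨1, by rw [map_one]; rfl⟩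
      symm := by
        rintro x y ⟨γ, rfl⟩
        refine ⟨γ⁻¹, ?_⟩
        change (X.obj.ρ γ ≫ X.obj.ρ γ⁻¹) x = x
        rw [← End.mul_def, ← map_mul, inv_mul_cancel, map_one]; rfl
      trans := by
        rintro x y z ⟨γ, rfl⟩ ⟨δ, rfl⟩
        exact ⟨δ * γ, by rw [map_mul]; rfl⟩ }

/-- The set of orbits of `X`. [cite: MochizukiSemiAnbd2006, Prop 3.6(ii) p.38] -/
def Orbit : Type u := Quotient (D.orbitSetoid h𝒢 X)

/-- The orbits of a countable `π₁^temp`-set are countable. [folklore] -/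
instance countable_orbit : Countable (D.Orbit h𝒢 X) := by
  haveI : Countable X.obj.V := X.property.1
  exact inferInstanceAs (Countable (Quotient (D.orbitSetoid h𝒢 X)))

/-- A representative of each orbit. [cite: MochizukiSemiAnbd2006, Prop 3.6(ii) p.38] -/
noncomputable def orep (o : D.Orbit h𝒢 X) : X.obj.V := Quotient.out (s := D.orbitSetoid h𝒢 X) o

/-- The orbit of a point. [cite: MochizukiSemiAnbd2006, Prop 3.6(ii) p.38] -/
def orbitOf (x : X.obj.V) : D.Orbit h𝒢 X := Quotient.mk (D.orbitSetoid h𝒢 X) x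

/-- Every point is a translate of the representative of its orbit. [cite: MochizukiSemiAnbd2006, Prop 3.6(ii) p.38] -/
theorem exists_ρ_orep_eq (x : X.obj.V) : ∃ γ : D.temperedPi h𝒢, X.obj.ρ γ (D.orep h𝒢 X (D.orbitOf h𝒢 X x)) = x :=
  Quotient.exact (s := D.orbitSetoid h𝒢 X) (Quotient.out_eq (s := D.orbitSetoid h𝒢 X)
    (Quotient.mk (D.orbitSetoid h𝒢 X) x))

/-- Translates lie in the same orbit. [cite: MochizukiSemiAnbd2006, Prop 3.6(ii) p.38] -/
theorem orbitOf_ρ (γ : D.temperedPi h𝒢) (x : X.obj.V) : D.orbitOf h𝒢 X (X.obj.ρ γ x) = D.orbitOf h𝒢 X x :=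
  (Quotient.sound (s := D.orbitSetoid h𝒢 X) ⟨γ, rfl⟩).symm

/-- The representative represents. [cite: MochizukiSemiAnbd2006, Prop 3.6(ii) p.38] -/
theorem orbitOf_orep (o : D.Orbit h𝒢 X) : D.orbitOf h𝒢 X (D.orep h𝒢 X o) = o :=
  Quotient.out_eq (s := D.orbitSetoid h𝒢 X) o

/-- The family of quotient coverings, one for each orbit. [cite: MochizukiSemiAnbd2006, Prop 3.6(ii) p.38] -/
noncomputable def orbitFamily (o : D.Orbit h𝒢 X) : CovObj 𝒢 := D.orbitCover h𝒢 X (D.orep h𝒢 X o)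

/-- **The covering realising `X`**: the disjoint union of the orbit quotient coverings.
[cite: MochizukiSemiAnbd2006, Prop 3.6(ii) p.38] -/
noncomputable def realize : CovObj 𝒢 := CovObj.sigma (D.orbitFamily h𝒢 X)

variable (hS : ∀ n, (D.S n).Splits (D.S n))

include hS in
/-- `realize X` is tempered. [cite: MochizukiSemiAnbd2006, Prop 3.6(ii) p.38] -/
theorem realize_isTempered (hfin : ∀ n, (D.S n).IsFinite) (hne : ∀ n, (D.S n).HasNonemptyFibres) :
    (D.realize h𝒢 X).IsTempered :=
  CovObj.sigma_isTempered _ fun _ => D.quotCover_isTempered h𝒢 _ _ (hS _) (hfin _) (hne _)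

/-- A covering splitting a summand splits the components of the disjoint union through it.
[cite: MochizukiSemiAnbd2006, Def 3.5(ii) p.37] -/
theorem splits_sigma_component {ι : Type u} [Countable ι] (T : ι → CovObj 𝒢) (F : CovObj 𝒢) (i : ι)
    (hF : F.Splits (T i)) (p : (T i).Point) :
    F.Splits ((CovObj.sigma T).component (CovObj.sigmaPt T i p)) := by
  refine ⟨fun v x g hgx s => ?_, fun e x g hgx s => ?_⟩
  · apply Subtype.ext
    obtain ⟨⟨j, xj⟩, hs⟩ := s
    obtain ⟨q, hq, _⟩ := CovObj.exists_of_sameComponent_sigmaPt T i p _ hs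
    rcases q with ⟨v', x'⟩ | ⟨e', y'⟩
    · change (Sum.inl ⟨v', ⟨i, x'⟩⟩ : (CovObj.sigma T).Point) = Sum.inl ⟨v, ⟨j, xj⟩⟩ at hq
      cases hq
      exact congrArg (Sigma.mk i) (hF.1 v x g hgx x')
    · exact absurd hq (by simp [CovObj.sigmaPt])
  · apply Subtype.ext
    obtain ⟨⟨j, yj⟩, hs⟩ := s
    obtain ⟨q, hq, _⟩ := CovObj.exists_of_sameComponent_sigmaPt T i p _ hs
    rcases q with ⟨v', x'⟩ | ⟨e', y'⟩
    · exact absurd hq (by simp [CovObj.sigmaPt])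
    · change (Sum.inr ⟨e', ⟨i, y'⟩⟩ : (CovObj.sigma T).Point) = Sum.inr ⟨e, ⟨j, yj⟩⟩ at hq
      cases hq
      exact congrArg (Sigma.mk i) (hF.2 e x g hgx y')

/-- Level function for `realize X`: the level of the orbit. [cite: MochizukiSemiAnbd2006, Prop 3.6(ii) p.38] -/
noncomputable def levR (s : ((D.realize h𝒢 X).SV D.v₀).obj.V) : ℕ := D.stabLevel h𝒢 X (D.orep h𝒢 X s.1)

include hS in
/-- The levels split the components of `realize X`. [cite: MochizukiSemiAnbd2006, Prop 3.6(ii) p.38] -/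
theorem hlevR (s : ((D.realize h𝒢 X).SV D.v₀).obj.V) (m : ℕ) (hm : D.levR h𝒢 X s ≤ m) :
    (D.S m).Splits ((D.realize h𝒢 X).component (Sum.inl ⟨D.v₀, s⟩)) := by
  obtain ⟨o, q⟩ := s
  exact splits_sigma_component (D.orbitFamily h𝒢 X) (D.S m) o
    (D.splits_of_le hm ((D.cover h𝒢 _).splits_quot _ (D.splits_cover h𝒢 _ (hS _)))) (Sum.inl ⟨D.v₀, q⟩)

/-- The action on `Φ(realize X)` is computed summand-wise. [cite: MochizukiSemiAnbd2006, Prop 3.6(ii) p.38] -/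
theorem piAct_realize (γ : D.temperedPi h𝒢) (o : D.Orbit h𝒢 X) (q : ((D.orbitFamily h𝒢 X o).SV D.v₀).obj.V) :
    D.piAct h𝒢 (D.realize h𝒢 X) (D.levR h𝒢 X) (D.hlevR h𝒢 X hS) γ ⟨o, q⟩ =
      ⟨o, D.piAct h𝒢 (D.orbitCover h𝒢 X (D.orep h𝒢 X o)) (fun _ => D.stabLevel h𝒢 X (D.orep h𝒢 X o))
        (D.orbitCover_hlev h𝒢 X (D.orep h𝒢 X o) hS) γ q⟩ :=
  (D.piAct_map h𝒢 (CovObj.sigmaIncl (D.orbitFamily h𝒢 X) o) (fun _ => D.stabLevel h𝒢 X (D.orep h𝒢 X o))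
    (D.orbitCover_hlev h𝒢 X (D.orep h𝒢 X o) hS) (D.levR h𝒢 X) (D.hlevR h𝒢 X hS) γ q).symm

/-- The comparison map `Φ(realize X) → X`: `⟨o, γ · [bp]⟩ ↦ γ · rep(o)`.
[cite: MochizukiSemiAnbd2006, Prop 3.6(ii) p.38] -/
noncomputable def theta (s : ((D.realize h𝒢 X).SV D.v₀).obj.V) : X.obj.V :=
  X.obj.ρ (D.exists_piAct_quotBase h𝒢 X (D.orep h𝒢 X s.1) hS s.2).choose (D.orep h𝒢 X s.1)

/-- `θ ⟨o, γ · [bp]⟩ = γ · rep(o)`. [cite: MochizukiSemiAnbd2006, Prop 3.6(ii) p.38] -/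
theorem theta_spec (o : D.Orbit h𝒢 X) (γ : D.temperedPi h𝒢) :
    D.theta h𝒢 X hS ⟨o, D.piAct h𝒢 (D.orbitCover h𝒢 X (D.orep h𝒢 X o))
      (fun _ => D.stabLevel h𝒢 X (D.orep h𝒢 X o)) (D.orbitCover_hlev h𝒢 X (D.orep h𝒢 X o) hS) γ
      (D.quotBase h𝒢 _ _)⟩ = X.obj.ρ γ (D.orep h𝒢 X o) :=
  (D.piAct_quotBase_eq_iff h𝒢 X (D.orep h𝒢 X o) hS _ γ).mp
    (D.exists_piAct_quotBase h𝒢 X (D.orep h𝒢 X o) hS _).choose_spec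

/-- `θ` is equivariant. [cite: MochizukiSemiAnbd2006, Prop 3.6(ii) p.38] -/
theorem theta_piAct (γ : D.temperedPi h𝒢) (s : ((D.realize h𝒢 X).SV D.v₀).obj.V) :
    D.theta h𝒢 X hS (D.piAct h𝒢 (D.realize h𝒢 X) (D.levR h𝒢 X) (D.hlevR h𝒢 X hS) γ s) =
      X.obj.ρ γ (D.theta h𝒢 X hS s) := by
  obtain ⟨o, q⟩ := s
  obtain ⟨δ, rfl⟩ := D.exists_piAct_quotBase h𝒢 X (D.orep h𝒢 X o) hS q
  rw [D.piAct_realize h𝒢 X hS, D.theta_spec h𝒢 X hS,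
    ← D.piAct_mul h𝒢 _ (fun _ => D.stabLevel h𝒢 X (D.orep h𝒢 X o)) (D.orbitCover_hlev h𝒢 X (D.orep h𝒢 X o) hS),
    D.theta_spec h𝒢 X hS, map_mul]
  rfl

/-- `θ` is injective. [cite: MochizukiSemiAnbd2006, Prop 3.6(ii) p.38] -/
theorem theta_injective : Function.Injective (D.theta h𝒢 X hS) := by
  rintro ⟨o, q⟩ ⟨o', q'⟩ h
  obtain ⟨δ, rfl⟩ := D.exists_piAct_quotBase h𝒢 X (D.orep h𝒢 X o) hS q
  obtain ⟨δ', rfl⟩ := D.exists_piAct_quotBase h𝒢 X (D.orep h𝒢 X o') hS q'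
  rw [D.theta_spec h𝒢 X hS, D.theta_spec h𝒢 X hS] at h
  have ho : o = o' := by
    rw [← D.orbitOf_orep h𝒢 X o, ← D.orbitOf_orep h𝒢 X o', ← D.orbitOf_ρ h𝒢 X δ, h, D.orbitOf_ρ]
  subst ho
  rw [(D.piAct_quotBase_eq_iff h𝒢 X (D.orep h𝒢 X o) hS δ δ').mpr h]

/-- `θ` is surjective. [cite: MochizukiSemiAnbd2006, Prop 3.6(ii) p.38] -/
theorem theta_surjective : Function.Surjective (D.theta h𝒢 X hS) := by
  intro x
  obtain ⟨γ, hγ⟩ := D.exists_ρ_orep_eq h𝒢 X x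
  exact ⟨⟨D.orbitOf h𝒢 X x, _⟩, (D.theta_spec h𝒢 X hS (D.orbitOf h𝒢 X x) γ).trans hγ⟩

/-- **`Φ(realize X) ≅ X`** in `B^temp(π₁^temp(𝒢))`. [cite: MochizukiSemiAnbd2006, Prop 3.6(ii) p.38] -/
noncomputable def realizeIso : D.fibreObj h𝒢 (D.realize h𝒢 X) (D.levR h𝒢 X) (D.hlevR h𝒢 X hS) ≅ X :=
  (temperedAction (D.temperedPi h𝒢)).isoMk
    (Action.mkIso (Equiv.ofBijective (D.theta h𝒢 X hS)
      ⟨D.theta_injective h𝒢 X hS, D.theta_surjective h𝒢 X hS⟩).toIso fun γ => by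
        apply ConcreteCategory.hom_ext
        intro s
        exact D.theta_piAct h𝒢 X hS γ s)

/-- `fibreObj` does not depend on the level function, up to a canonical isomorphism.
[cite: MochizukiSemiAnbd2006, Prop 3.6(ii) p.38] -/
noncomputable def fibreObjIsoOfLev (T : CovObj 𝒢) (lev lev' : (T.SV D.v₀).obj.V → ℕ)
    (hlev : ∀ t n, lev t ≤ n → (D.S n).Splits (T.component (Sum.inl ⟨D.v₀, t⟩)))
    (hlev' : ∀ t n, lev' t ≤ n → (D.S n).Splits (T.component (Sum.inl ⟨D.v₀, t⟩))) :
    D.fibreObj h𝒢 T lev hlev ≅ D.fibreObj h𝒢 T lev' hlev' :=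
  (temperedAction (D.temperedPi h𝒢)).isoMk
    (Action.mkIso (Iso.refl _) fun γ => by
      apply ConcreteCategory.hom_ext
      intro t
      change D.piAct h𝒢 T lev hlev γ t = D.piAct h𝒢 T lev' hlev' γ t
      unfold piAct
      rw [← D.actAt_proj_eq h𝒢 T lev hlev t γ _ (le_max_left (lev t) (lev' t)),
        ← D.actAt_proj_eq h𝒢 T lev' hlev' t γ _ (le_max_right (lev t) (lev' t))])

end GaloisLevelData

end ProfiniteSemiGraph

end Literature.AnabelianGeometry.SemiGraphs
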